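import Literature.MathematicalPhysics.QuantumFieldTheory.ConformalBootstrap3D.PointKernelK34v2Data

/-!
# K34v2 certificate, kernel block file H4: head segments `39 ≤ i < 46` (block-checked ones)

`decide` by kernel reduction (no `native_decide`, no extra axioms) of the block checker
`PCert.hBlockOK` of `PointKernel` on the literal data of `PointKernelK34v2Data` (cells checked corner
or chord by the rule bit); soundness is `PCert.hBlockOK_sound`.  Estimated kernel time 236 s
(4 theorems).
-/

set_option maxRecDepth 100000
set_option maxHeartbeats 0

namespace Literature.MathematicalPhysics.QuantumFieldTheory.ConformalBootstrap3D.PointKernelK34v2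

open Literature.MathematicalPhysics.QuantumFieldTheory.ConformalBootstrap3D.PointKernel

/-- head segments `[39, 41)` pass the kernel evaluator (≈64 s of kernel work). [folklore] -/
theorem hBlock_39 : certK34v2.hBlockOK hsegsK34v2 39 41 JHK34v2 = true := by
  decide +kernel

/-- head segment `[41, 42)` passes the kernel evaluator (≈39 s of kernel work). [folklore] -/
theorem hBlock_41 : certK34v2.hBlockOK hsegsK34v2 41 42 JHK34v2 = true := by
  decide +kernel

/-- head segments `[42, 44)` pass the kernel evaluator (≈58 s of kernel work). [folklore] -/
theorem hBlock_42 : certK34v2.hBlockOK hsegsK34v2 42 44 JHK34v2 = true := by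
  decide +kernel

/-- head segments `[44, 46)` pass the kernel evaluator (≈63 s of kernel work). [folklore] -/
theorem hBlock_44 : certK34v2.hBlockOK hsegsK34v2 44 46 JHK34v2 = true := by
  decide +kernel

end Literature.MathematicalPhysics.QuantumFieldTheory.ConformalBootstrap3D.PointKernelK34v2
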